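import Summits.Ventures.Crystal3D.Bulk.GapHullEuler
import HarnessLib

/-!
# The component count of the oriented tight map: `k = 1` iff the tight graph is connected;
# Euler's relation `V′ − E + F° = 2` under connectedness (`phase2/LEAN-FACES-DESIGN.md` §5.3)

HONEST FRAMING. Part of the venture `Summits/Ventures/Crystal3D` (cell `pub-crystal3d`, phase 2;
seat p3). Kernel theorems about an admissible fourteen-ball configuration `c` (`IsGapConfig c`,
`intruderDist c < 3/2`); nothing here asserts anything about GAP(1.26). `Bulk/GapHullEuler.lean`
proves `2·#activeVertices c − #darts c + 2·onumFaces c = 4·k` with `k = RotSys.numK` the number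
of connected components of the oriented tight map as an induced rotation system. This file
identifies that `k` with the elementary connectivity of the TIGHT GRAPH (vertices = active balls,
edges = tight pairs), which is what the census's structural assumption P-L3(b) L1 («T′ is
connected») asserts — connectedness itself is NOT proved here:

* `TightConnected c` — closure form: every nonempty set of active vertices closed under tight
  adjacency is all of `activeVertices c`;
* `IsGapConfig.conn_tight_of_tightConnected` — then any two tight darts are `RotSys.conn`-related;
  **`IsGapConfig.numK_eq_one_of_tightConnected`** — `k = 1`;
* **`IsGapConfig.oriented_euler_of_tightConnected`** —
  `2·#activeVertices c − #darts c + 2·onumFaces c = 4`, i.e. `V′ − E + F° = 2`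
  (`#activeVertices c − tightCount c + onumFaces c = 2`);
* the converse `IsGapConfig.tightConnected_of_numK_eq_one` (invariance of the tail's membership
  along `conn`, `tail_mem_iff_of_conn`) and **`IsGapConfig.numK_eq_one_iff_tightConnected`**:
  `k = 1` is EXACTLY the connectedness of the tight graph.
-/

noncomputable section

namespace Summit.Ventures.Crystal3D

open Literature.Geometry.DiscreteGeometry Finset Equiv HullRotSys

variable {c : Fin 14 → EuclideanSpace ℝ (Fin 3)}

/-- **The tight graph is connected** (closure form): every nonempty set of active vertices that
contains, with a vertex, all its tight partners, is the whole set of active vertices. This is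
the census's structural assumption P-L3(b) L1 for the tight map `T′`; it is NOT proved here. -/
def TightConnected (c : Fin 14 → EuclideanSpace ℝ (Fin 3)) : Prop :=
  ∀ A : Finset (Fin 14), A ⊆ activeVertices c → A.Nonempty →
    (∀ i ∈ A, ∀ j : Fin 14, (i, j) ∈ darts c → j ∈ A) → A = activeVertices c

/-- Tight darts with the same tail are `conn`-related (they lie on one vertex cycle of `σ_H`). -/
theorem IsGapConfig.conn_tight_of_fst_eq (hc : IsGapConfig c)
    {q q' : Fin 14 × Fin 14} (hq : q ∈ darts c) (hq' : q' ∈ darts c) (h : q.1 = q'.1)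
    {d d' : ↥(hullDarts (dirSet c))} (hd : d.1 = dirPair c q) (hd' : d'.1 = dirPair c q') :
    RotSys.conn hc.hullRot (inv (dirSet c)) (tightDartsH c) d d' := by
  refine RotSys.conn_of_sameCycle (mem_tightDartsH.2 ⟨q, hq, hd.symm⟩)
    (mem_tightDartsH.2 ⟨q', hq', hd'.symm⟩) ?_
  unfold IsGapConfig.hullRot
  rw [sameCycle_rot_iff, hd, hd']
  show gapDir c q.1 = gapDir c q'.1
  rw [h]

/-- The reversed tight dart is connected to the dart. -/
theorem IsGapConfig.conn_tight_swap (hc : IsGapConfig c)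
    {q : Fin 14 × Fin 14} (hq : q ∈ darts c) {d d' : ↥(hullDarts (dirSet c))}
    (hd : d.1 = dirPair c q) (hd' : d'.1 = dirPair c q.swap) :
    RotSys.conn hc.hullRot (inv (dirSet c)) (tightDartsH c) d d' := by
  have hdT : d ∈ tightDartsH c := mem_tightDartsH.2 ⟨q, hq, hd.symm⟩
  have h := RotSys.conn_alpha (σ := hc.hullRot) (isClosed_tightDartsH c) hdT
  have he : inv (dirSet c) d = d' := by
    apply Subtype.ext
    rw [inv_apply_val, hd, hd', dirPair_swap]
  rw [he] at h
  exact h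

/-- **Under `TightConnected`, any two tight darts are connected** in the induced rotation
system. -/
theorem IsGapConfig.conn_tight_of_tightConnected (hc : IsGapConfig c)
    (hD : intruderDist c < 3 / 2) (hconn : TightConnected c) {d d' : ↥(hullDarts (dirSet c))}
    (hd : d ∈ tightDartsH c) (hd' : d' ∈ tightDartsH c) :
    RotSys.conn hc.hullRot (inv (dirSet c)) (tightDartsH c) d d' := by
  classical
  obtain ⟨q₀, hq₀, hq₀d⟩ := mem_tightDartsH.1 hd
  obtain ⟨q', hq', hq'd⟩ := mem_tightDartsH.1 hd'
  -- the tails of the tight darts connected to `d`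
  set A : Finset (Fin 14) := ((darts c).filter fun q => ∃ e ∈ tightDartsH c,
      e.1 = dirPair c q ∧ RotSys.conn hc.hullRot (inv (dirSet c)) (tightDartsH c) d e).image
    Prod.fst with hA
  have hmemA : ∀ {i : Fin 14}, i ∈ A ↔ ∃ q ∈ darts c, q.1 = i ∧ ∃ e ∈ tightDartsH c,
      e.1 = dirPair c q ∧ RotSys.conn hc.hullRot (inv (dirSet c)) (tightDartsH c) d e := by
    intro i
    rw [hA, mem_image]
    constructor
    · rintro ⟨q, hq, rfl⟩
      rw [mem_filter] at hq
      exact ⟨q, hq.1, rfl, hq.2⟩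
    · rintro ⟨q, hq, rfl, he⟩
      exact ⟨q, mem_filter.2 ⟨hq, he⟩, rfl⟩
  have hAsub : A ⊆ activeVertices c := by
    intro i hi
    obtain ⟨q, hq, rfl, -⟩ := hmemA.1 hi
    rw [← image_fst_darts]; exact mem_image_of_mem _ hq
  have hAne : A.Nonempty :=
    ⟨q₀.1, hmemA.2 ⟨q₀, hq₀, rfl, d, hd, hq₀d.symm, RotSys.conn_refl _ _ _ _⟩⟩
  have hAcl : ∀ i ∈ A, ∀ j : Fin 14, (i, j) ∈ darts c → j ∈ A := by
    intro i hi j hij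
    obtain ⟨q₁, hq₁, hq₁i, e₁, he₁, he₁q, hc₁⟩ := hmemA.1 hi
    -- the dart `(i, j)` lies at the same vertex as `q₁`, its reverse at `j`
    set e : ↥(hullDarts (dirSet c)) := ⟨dirPair c (i, j), hc.dirPair_mem_hullDarts hD hij⟩ with he
    set e' : ↥(hullDarts (dirSet c)) := ⟨dirPair c (j, i), hc.dirPair_mem_hullDarts hD
      (swap_mem_darts hij)⟩ with he'
    have h1 : RotSys.conn hc.hullRot (inv (dirSet c)) (tightDartsH c) e₁ e :=
      hc.conn_tight_of_fst_eq hq₁ hij hq₁i he₁q rfl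
    have h2 : RotSys.conn hc.hullRot (inv (dirSet c)) (tightDartsH c) e e' :=
      hc.conn_tight_swap hij rfl rfl
    exact hmemA.2 ⟨(j, i), swap_mem_darts hij, rfl, e', mem_tightDartsH.2 ⟨(j, i),
      swap_mem_darts hij, rfl⟩, rfl, RotSys.conn_trans (RotSys.conn_trans hc₁ h1) h2⟩
  have hAall : A = activeVertices c := hconn A hAsub hAne hAcl
  -- the tail of `d'` is active, hence in `A`
  have hq'1 : q'.1 ∈ A := by
    rw [hAall, ← image_fst_darts]; exact mem_image_of_mem _ hq'
  obtain ⟨q₂, hq₂, hq₂1, e₂, he₂, he₂q, hc₂⟩ := hmemA.1 hq'1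
  exact RotSys.conn_trans hc₂ (hc.conn_tight_of_fst_eq hq₂ hq' hq₂1 he₂q hq'd.symm)

/-- **`k = 1` under `TightConnected`**: the induced rotation system on the tight darts has one
connected component (for a configuration with at least one tight pair). -/
theorem IsGapConfig.numK_eq_one_of_tightConnected (hc : IsGapConfig c)
    (hD : intruderDist c < 3 / 2) (hconn : TightConnected c) (hne : (darts c).Nonempty) :
    RotSys.numK hc.hullRot (inv (dirSet c)) (tightDartsH c) = 1 := by
  classical
  unfold RotSys.numK
  rw [numClasses_eq_card_image (fun _ : ↥(hullDarts (dirSet c)) => (0 : ℕ))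
    (fun d hd d' hd' => iff_of_true (hc.conn_tight_of_tightConnected hD hconn hd hd') rfl)]
  obtain ⟨q, hq⟩ := hne
  have hT : (tightDartsH c).Nonempty :=
    ⟨⟨dirPair c q, hc.dirPair_mem_hullDarts hD hq⟩, mem_tightDartsH.2 ⟨q, hq, rfl⟩⟩
  rw [image_const hT, card_singleton]

/-- **Euler's relation `V′ − E + F° = 2` for a CONNECTED oriented tight map** (doubled, with
`#darts = 2E`): `2·#activeVertices c − #darts c + 2·onumFaces c = 4`. -/
theorem IsGapConfig.oriented_euler_of_tightConnected (hc : IsGapConfig c)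
    (hD : intruderDist c < 3 / 2) (hconn : TightConnected c) (hne : (darts c).Nonempty) :
    2 * ((activeVertices c).card : ℤ) - (darts c).card + 2 * (onumFaces c : ℤ) = 4 := by
  rw [hc.oriented_euler hD, hc.numK_eq_one_of_tightConnected hD hconn hne]
  norm_num

/-- The same as `V′ − E + F° = 2` with `E = tightCount c`. -/
theorem IsGapConfig.oriented_euler_of_tightConnected' (hc : IsGapConfig c)
    (hD : intruderDist c < 3 / 2) (hconn : TightConnected c) (hne : (darts c).Nonempty) :
    ((activeVertices c).card : ℤ) - tightCount c + onumFaces c = 2 := by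
  have h := hc.oriented_euler_of_tightConnected hD hconn hne
  rw [card_darts] at h
  push_cast at h
  omega

/-! ## The converse: one component forces a connected tight graph -/

section Classes

open scoped Classical

/-- If a reflexive relation has ONE class on `S`, any two elements of `S` are related. -/
theorem rel_of_numClasses_eq_one {D : Type*} [DecidableEq D] {R : D → D → Prop} {S : Finset D}
    (hrefl : ∀ x ∈ S, R x x) (h : RotSys.numClasses R S = 1) {x y : D} (hx : x ∈ S)
    (hy : y ∈ S) : R x y := by
  unfold RotSys.numClasses at h
  obtain ⟨C, hC⟩ := card_eq_one.1 h
  have hcls : ∀ z ∈ S, (S.filter fun w => R z w) = C := fun z hz => by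
    have hm := mem_image_of_mem (fun z => S.filter fun w => R z w) hz
    rw [hC, mem_singleton] at hm
    exact hm
  have hyy : y ∈ S.filter fun w => R y w := mem_filter.2 ⟨hy, hrefl y hy⟩
  rw [hcls y hy, ← hcls x hx, mem_filter] at hyy
  exact hyy.2

end Classes

/-- If the induced system has ONE class, any two tight darts are `conn`-related. -/
theorem IsGapConfig.conn_of_numK_eq_one (hc : IsGapConfig c)
    (hk : RotSys.numK hc.hullRot (inv (dirSet c)) (tightDartsH c) = 1)
    {d d' : ↥(hullDarts (dirSet c))} (hd : d ∈ tightDartsH c) (hd' : d' ∈ tightDartsH c) :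
    RotSys.conn hc.hullRot (inv (dirSet c)) (tightDartsH c) d d' :=
  rel_of_numClasses_eq_one (fun x _ => RotSys.conn_refl _ _ _ x) hk hd hd'

/-- Along `conn`, membership of the tail in a set closed under tight adjacency is invariant. -/
theorem IsGapConfig.tail_mem_iff_of_conn (hc : IsGapConfig c) (hD : intruderDist c < 3 / 2)
    {A : Finset (Fin 14)} (hAcl : ∀ i ∈ A, ∀ j : Fin 14, (i, j) ∈ darts c → j ∈ A)
    {x y : ↥(hullDarts (dirSet c))}
    (h : RotSys.conn hc.hullRot (inv (dirSet c)) (tightDartsH c) x y) :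
    (∀ q ∈ darts c, dirPair c q = x.1 → q.1 ∈ A) ↔ (∀ q ∈ darts c, dirPair c q = y.1 → q.1 ∈ A)
        := by
  have hD2 : intruderDist c < 2 := by linarith
  -- with a chosen index pair the predicate is membership of its tail
  have key : ∀ {z : ↥(hullDarts (dirSet c))} {q : Fin 14 × Fin 14}, q ∈ darts c →
      dirPair c q = z.1 → ((∀ q' ∈ darts c, dirPair c q' = z.1 → q'.1 ∈ A) ↔ q.1 ∈ A) := by
    intro z q hq hqz
    constructor
    · exact fun hall => hall q hq hqz
    · intro hq1 q' hq' hq'z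
      have : q' = q := hc.dirPair_injOn hD2 (Finset.mem_coe.2 hq') (Finset.mem_coe.2 hq)
        (hq'z.trans hqz.symm)
      rw [this]; exact hq1
  induction h with
  | rel x y hxy =>
    obtain ⟨hx, hy, hadj⟩ := hxy
    obtain ⟨qx, hqx, hqxe⟩ := mem_tightDartsH.1 hx
    obtain ⟨qy, hqy, hqye⟩ := mem_tightDartsH.1 hy
    rw [key hqx hqxe, key hqy hqye]
    rcases hadj with hcyc | hal
    · -- same vertex: same tail
      unfold IsGapConfig.hullRot at hcyc
      rw [sameCycle_rot_iff, ← hqxe, ← hqye] at hcyc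
      have : qx.1 = qy.1 :=
        hc.eq_of_gapDir_eq hD2 (mem_darts.1 hqx).1 (mem_darts.1 hqy).1 hcyc
      rw [this]
    · -- opposite darts: `qy = qx.swap`
      have hval : dirPair c qy = dirPair c qx.swap := by
        rw [hqye, hal, inv_apply_val, ← hqxe, dirPair_swap]
      have hq : qy = qx.swap :=
        hc.dirPair_injOn hD2 (Finset.mem_coe.2 hqy) (Finset.mem_coe.2 (swap_mem_darts hqx)) hval
      rw [hq]
      constructor
      · exact fun h1 => hAcl _ h1 _ hqx
      · exact fun h2 => hAcl _ h2 _ (swap_mem_darts hqx)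
  | refl x => exact Iff.rfl
  | symm x y _ ih => exact ih.symm
  | trans x y z _ _ ih1 ih2 => exact ih1.trans ih2

/-- **One component ⇒ the tight graph is connected.** -/
theorem IsGapConfig.tightConnected_of_numK_eq_one (hc : IsGapConfig c)
    (hD : intruderDist c < 3 / 2)
    (hk : RotSys.numK hc.hullRot (inv (dirSet c)) (tightDartsH c) = 1) : TightConnected c := by
  intro A hAsub hAne hAcl
  refine Subset.antisymm hAsub fun i hi => ?_
  obtain ⟨i₀, hi₀⟩ := hAne
  obtain ⟨hi₀0, j₀, hj₀⟩ := mem_activeVertices.1 (hAsub hi₀)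
  obtain ⟨hi0, j, hj⟩ := mem_activeVertices.1 hi
  have hq₀ : (i₀, j₀) ∈ darts c := mk_mem_darts hi₀0 hj₀
  have hq : (i, j) ∈ darts c := mk_mem_darts hi0 hj
  set d₀ : ↥(hullDarts (dirSet c)) := ⟨dirPair c (i₀, j₀), hc.dirPair_mem_hullDarts hD hq₀⟩
  set d : ↥(hullDarts (dirSet c)) := ⟨dirPair c (i, j), hc.dirPair_mem_hullDarts hD hq⟩
  have hconn := hc.conn_of_numK_eq_one hk (d := d₀) (d' := d)
    (mem_tightDartsH.2 ⟨(i₀, j₀), hq₀, rfl⟩) (mem_tightDartsH.2 ⟨(i, j), hq, rfl⟩)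
  have hiff := hc.tail_mem_iff_of_conn hD hAcl hconn
  have hD2 : intruderDist c < 2 := by linarith
  have hP0 : ∀ q ∈ darts c, dirPair c q = d₀.1 → q.1 ∈ A := by
    intro q hq' hqe
    have : q = (i₀, j₀) :=
      hc.dirPair_injOn hD2 (Finset.mem_coe.2 hq') (Finset.mem_coe.2 hq₀) hqe
    rw [this]; exact hi₀
  exact hiff.1 hP0 (i, j) hq rfl

/-- **`k = 1` iff the tight graph is connected** (for a configuration with a tight pair). -/
theorem IsGapConfig.numK_eq_one_iff_tightConnected (hc : IsGapConfig c)
    (hD : intruderDist c < 3 / 2) (hne : (darts c).Nonempty) :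
    RotSys.numK hc.hullRot (inv (dirSet c)) (tightDartsH c) = 1 ↔ TightConnected c :=
  ⟨hc.tightConnected_of_numK_eq_one hD, fun h => hc.numK_eq_one_of_tightConnected hD h hne⟩

end Summit.Ventures.Crystal3D
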